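import Literature.Geometry.Lorentzian.DecaySymbolsInverse
import Literature.Geometry.Lorentzian.DecaySymbolsLinear
import Literature.Geometry.Lorentzian.DecaySymbolsSqrt
import HarnessLib

/-!
# Smooth symbols under rigid motions of the chart

Continuation of the `O_k(r^a)` calculus of `DecaySymbols*.lean` (`IsBigOSmooth k a f`: `f` is
`C^∞` far out and `‖∂^m f(y)‖ = O(‖y‖^{a-m})`, `m ≤ k`). An asymptotically flat chart is only
determined up to a Euclidean motion `y ↦ g y + c` (rotation of the axes, shift of the origin —
"centre of mass" translations), and every decay class of the tree is invariant under them; this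
file supplies the bookkeeping:

* `isBigO_norm_add_const_rpow` — `‖y + c‖^s ≍ ‖y‖^s` at infinity (both signs of `s`);
* `IsBigOSmooth.comp_add_const`, `IsBigOSmooth.comp_linearIsometryEquiv`,
  `IsBigOSmooth.comp_rigid` — a symbol of order `a` composed with a translation, a linear
  isometry, or a rigid motion `y ↦ g y + c` is a symbol of order `a`
  (`iteratedFDeriv_comp_add_right`, `LinearIsometryEquiv.norm_iteratedFDeriv_comp_right`);
* `isBigOSmooth_two_norm_sq`, `isBigOSmooth_two_norm` — `r²`, `r` are symbols of order `2`, `1`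
  on any real inner product space (the `E3` versions are in `KerrBoyerLindquistDecay.lean`);
* **`isBigOSmooth_inv_norm_add_const_sub`** — `1/‖y + c‖ − 1/‖y‖ ∈ O₂(r⁻²)`: shifting the
  origin changes the Newtonian potential `M/r` by a term of one order lower
  (`= −(2⟪y,c⟫ + ‖c‖²)/((‖y‖ + ‖y+c‖)‖y‖‖y+c‖)`), which is why the mass aspect `(1 + 2M/r)δ`
  and the Dafermos–Rodnianski / Regge–Teitelboim decay classes do not depend on the origin;
* `ContinuousLinearMap.exists_bilinearCompCLM`, `innerSL_bilinearComp_linearIsometryEquiv` —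
  conjugation `T ↦ T(g·, g·)` of bilinear forms is a continuous linear map, and fixes `δ`;
* **`IsBigOSmooth.massAspect_comp_rigid`** — if `h − (1 + 2M/r)δ ∈ O₂(r⁻²)` then the rigidly
  moved chart metric `y ↦ h(g y + c)(g·, g·)` has the same property with the SAME `M`; and
  `IsBigOSmooth.bilinForm_comp_rigid` for a form of any order (e.g. `k ∈ O₁(r⁻³)`).

Everything is proved; no definitions of `Prop` type, no named facts.

## References

* T. Regge, C. Teitelboim, Ann. Phys. 88 (1974) 286, §5 (asymptotic Poincaré transformations of
  asymptotically flat data; the parity/decay classes are frame independent).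
* R. Bartnik, CPAM 39 (1986) 661, §4 (independence of the mass of the asymptotic structure).
-/

noncomputable section

open Set Filter Asymptotics Bornology Topology
open scoped ContDiff InnerProductSpace

namespace Literature.Geometry.Lorentzian

/-! ### `‖y + c‖^s ≍ ‖y‖^s` at infinity -/

section Normed

variable {E : Type*} [NormedAddCommGroup E]

/-- Far out, `‖y‖/2 ≤ ‖y + c‖ ≤ 2‖y‖`. [folklore] -/
theorem eventually_norm_add_const_bounds (c : E) :
    ∀ᶠ y in cobounded E, ‖y‖ / 2 ≤ ‖y + c‖ ∧ ‖y + c‖ ≤ 2 * ‖y‖ := by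
  filter_upwards [eventually_cobounded_lt_norm (E := E) (2 * ‖c‖)] with y hy
  have h1 : ‖y‖ - ‖c‖ ≤ ‖y + c‖ := by
    have := norm_sub_le (y + c) c
    rw [add_sub_cancel_right] at this
    linarith
  have h2 : ‖y + c‖ ≤ ‖y‖ + ‖c‖ := norm_add_le y c
  have hc : 0 ≤ ‖c‖ := norm_nonneg c
  constructor <;> linarith

/-- **`‖y + c‖^s = O(‖y‖^s)` at infinity**, for every real `s` (constant `2^{|s|}`). [folklore] -/
theorem isBigO_norm_add_const_rpow [NormedSpace ℝ E] (c : E) (s : ℝ) :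
    (fun y : E ↦ ‖y + c‖ ^ s) =O[cobounded E] fun y ↦ ‖y‖ ^ s := by
  refine IsBigO.of_bound (2 ^ |s|) ?_
  filter_upwards [eventually_norm_add_const_bounds c,
    eventually_cobounded_lt_norm (E := E) 0] with y ⟨hlo, hhi⟩ hy0
  have hyc : 0 < ‖y + c‖ := by linarith
  rw [Real.norm_of_nonneg (by positivity), Real.norm_of_nonneg (by positivity)]
  rcases le_or_gt 0 s with hs | hs
  · rw [abs_of_nonneg hs]
    calc ‖y + c‖ ^ s ≤ (2 * ‖y‖) ^ s := Real.rpow_le_rpow (norm_nonneg _) hhi hs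
      _ = 2 ^ s * ‖y‖ ^ s := Real.mul_rpow (by norm_num) (norm_nonneg _)
  · rw [abs_of_neg hs]
    calc ‖y + c‖ ^ s ≤ (‖y‖ / 2) ^ s := Real.rpow_le_rpow_of_nonpos (by positivity) hlo hs.le
      _ = 2 ^ (-s) * ‖y‖ ^ s := by
        rw [div_eq_mul_inv, Real.mul_rpow (norm_nonneg _) (by norm_num),
          Real.inv_rpow (by norm_num : (0 : ℝ) ≤ 2), Real.rpow_neg (by norm_num : (0 : ℝ) ≤ 2)]
        ring

/-- Translations tend to infinity at infinity. [folklore] -/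
theorem tendsto_add_const_cobounded (c : E) :
    Tendsto (fun y : E ↦ y + c) (cobounded E) (cobounded E) :=
  (IsometryEquiv.addRight c).isometry.antilipschitz.tendsto_cobounded

end Normed

/-! ### Symbols composed with translations, linear isometries, rigid motions -/

namespace IsBigOSmooth

variable {E : Type*} [NormedAddCommGroup E] [NormedSpace ℝ E]
  {E' : Type*} [NormedAddCommGroup E'] [NormedSpace ℝ E']
  {W : Type*} [NormedAddCommGroup W] [NormedSpace ℝ W]
  {k : ℕ} {a : ℝ} {f : E → W}

/-- **A symbol composed with a translation is a symbol of the same order**: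
`∂^m (f(· + c))(y) = (∂^m f)(y + c)` and `‖y + c‖^{a-m} ≍ ‖y‖^{a-m}`. [folklore] -/
theorem comp_add_const (hf : IsBigOSmooth k a f) (c : E) :
    IsBigOSmooth k a fun y ↦ f (y + c) := by
  obtain ⟨⟨R₀, hR₀⟩, hO⟩ := hf
  refine ⟨⟨R₀ + ‖c‖, fun y hy ↦ ?_⟩, fun m hm ↦ ?_⟩
  · have hyc : R₀ < ‖y + c‖ := by
      have := norm_sub_le (y + c) c
      rw [add_sub_cancel_right] at this
      simp only [mem_setOf_eq] at hy
      linarith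
    exact ((hR₀.contDiffAt ((isOpen_setOf_lt_norm R₀).mem_nhds hyc)).comp y
      (contDiffAt_id.add contDiffAt_const)).contDiffWithinAt
  · have h1 : (fun y : E ↦ ‖iteratedFDeriv ℝ m (fun y ↦ f (y + c)) y‖) =
        fun y ↦ ‖iteratedFDeriv ℝ m f (y + c)‖ := by
      funext y
      rw [iteratedFDeriv_comp_add_right]
    rw [h1]
    exact ((hO m hm).comp_tendsto (tendsto_add_const_cobounded c)).trans
      (isBigO_norm_add_const_rpow c (a - m))

/-- **A symbol composed with a linear isometry is a symbol of the same order**: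
`‖∂^m (f ∘ g)(y)‖ = ‖(∂^m f)(g y)‖` and `‖g y‖ = ‖y‖`. [folklore] -/
theorem comp_linearIsometryEquiv (hf : IsBigOSmooth k a f) (g : E' ≃ₗᵢ[ℝ] E) :
    IsBigOSmooth k a fun y ↦ f (g y) := by
  obtain ⟨⟨R₀, hR₀⟩, hO⟩ := hf
  refine ⟨⟨R₀, ?_⟩, fun m hm ↦ ?_⟩
  · have h := hR₀.comp_continuousLinearMap (g : E' →L[ℝ] E)
    have hs : (g : E' →L[ℝ] E) ⁻¹' {y : E | R₀ < ‖y‖} = {y : E' | R₀ < ‖y‖} := by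
      ext y
      simp
    rw [hs] at h
    exact h
  · have h1 : (fun y : E' ↦ ‖iteratedFDeriv ℝ m (fun y ↦ f (g y)) y‖) =
        fun y ↦ ‖iteratedFDeriv ℝ m f (g y)‖ := by
      funext y
      exact g.norm_iteratedFDeriv_comp_right f y m
    have h2 : (fun y : E' ↦ ‖g y‖ ^ (a - m)) = fun y ↦ ‖y‖ ^ (a - m) := by
      funext y
      rw [g.norm_map]
    rw [h1, ← h2]
    exact (hO m hm).comp_tendsto g.antilipschitz.tendsto_cobounded

/-- **A symbol composed with a rigid motion `y ↦ g y + c` is a symbol of the same order.**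
[folklore] -/
theorem comp_rigid (hf : IsBigOSmooth k a f) (g : E' ≃ₗᵢ[ℝ] E) (c : E) :
    IsBigOSmooth k a fun y ↦ f (g y + c) :=
  (hf.comp_add_const c).comp_linearIsometryEquiv g

end IsBigOSmooth

/-! ### `r²`, `r`, and the shifted potential `1/‖y + c‖ − 1/‖y‖` -/

section Inner

variable {E : Type*} [NormedAddCommGroup E] [InnerProductSpace ℝ E]

/-- `r² = ⟪y, y⟫` is a symbol of order `2` (to second order) on a real inner product space.
[folklore] -/
theorem isBigOSmooth_two_norm_sq : IsBigOSmooth 2 2 fun y : E ↦ ‖y‖ ^ 2 := by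
  have h := IsBigOSmooth.bilin (innerSL ℝ (E := E) : E →L[ℝ] E →L[ℝ] ℝ)
    (isBigOSmooth_two_clm (ContinuousLinearMap.id ℝ E))
    (isBigOSmooth_two_clm (ContinuousLinearMap.id ℝ E))
  rw [show (1 : ℝ) + 1 = 2 by norm_num] at h
  refine h.congr fun y ↦ ?_
  show ⟪y, y⟫_ℝ = ‖y‖ ^ 2
  exact real_inner_self_eq_norm_sq y

/-- `r` is a symbol of order `1` (to second order) on a real inner product space
(`r = r² · r⁻¹` off the origin). [folklore] -/
theorem isBigOSmooth_two_norm : IsBigOSmooth 2 1 fun y : E ↦ ‖y‖ := by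
  have h := isBigOSmooth_two_norm_sq.mul (isBigOSmooth_inv_norm (E := E))
  rw [show (2 : ℝ) + -1 = 1 by norm_num] at h
  refine h.congr_far (R₁ := 0) fun y hy ↦ ?_
  have hy0 : ‖y‖ ≠ 0 := hy.ne'
  field_simp

/-- `‖y‖² − ‖y + c‖² = −(2⟪y, c⟫ + ‖c‖²)`. [folklore] -/
theorem norm_sq_sub_norm_add_sq (y c : E) :
    ‖y‖ ^ 2 - ‖y + c‖ ^ 2 = -(2 * ⟪y, c⟫_ℝ + ‖c‖ ^ 2) := by
  rw [norm_add_sq_real]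
  ring

/-- **Shifting the origin changes `1/r` at one order lower**:
`1/‖y + c‖ − 1/‖y‖ ∈ O₂(r⁻²)`. Write `1/q − 1/p = (p − q)/(pq) = (p² − q²)/((p + q) p q)` with
`p = ‖y‖`, `q = ‖y + c‖`, `p² − q² = −(2⟪y,c⟫ + ‖c‖²) ∈ O₂(r)`, `(p + q)⁻¹, p⁻¹, q⁻¹ ∈ O₂(r⁻¹)`
(`p + q ≥ r` is elliptic of order `1`). Regge–Teitelboim 1974, §5. [folklore] -/
theorem isBigOSmooth_inv_norm_add_const_sub (c : E) :
    IsBigOSmooth 2 (-2) fun y : E ↦ ‖y + c‖⁻¹ - ‖y‖⁻¹ := by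
  -- the numerator `N = 2⟪y,c⟫ + ‖c‖²` is a symbol of order `1`
  have hN : IsBigOSmooth 2 1 fun y : E ↦ 2 * ⟪y, c⟫_ℝ + ‖c‖ ^ 2 := by
    have h1 : IsBigOSmooth 2 1 fun y : E ↦ 2 * ⟪y, c⟫_ℝ :=
      ((isBigOSmooth_two_clm (innerSL ℝ c : E →L[ℝ] ℝ)).const_mul 2).congr fun y ↦ by
        simp only [innerSL_apply_apply, real_inner_comm c y]
    exact h1.add ((isBigOSmooth_const 2 (‖c‖ ^ 2)).mono (by norm_num))
  -- `S = ‖y‖ + ‖y + c‖` is an elliptic symbol of order `1`, so `S⁻¹ ∈ O₂(r⁻¹)`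
  have hS : IsBigOSmooth 2 1 fun y : E ↦ ‖y‖ + ‖y + c‖ :=
    isBigOSmooth_two_norm.add (isBigOSmooth_two_norm.comp_add_const c)
  have hSinv : IsBigOSmooth 2 (-1) fun y : E ↦ (‖y‖ + ‖y + c‖)⁻¹ := by
    refine hS.inv_of_elliptic one_pos (Eventually.of_forall fun y ↦ ?_)
    rw [Real.rpow_one, one_mul]
    linarith [norm_nonneg (y + c)]
  -- the product `−N · S⁻¹ · r⁻¹ · ‖y + c‖⁻¹ ∈ O₂(r⁻²)`
  have hP := ((hN.neg.mul hSinv).mul (isBigOSmooth_inv_norm (E := E))).mul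
    ((isBigOSmooth_inv_norm (E := E)).comp_add_const c)
  have hP' : IsBigOSmooth 2 (-2) fun y : E ↦
      -(2 * ⟪y, c⟫_ℝ + ‖c‖ ^ 2) * (‖y‖ + ‖y + c‖)⁻¹ * ‖y‖⁻¹ * ‖y + c‖⁻¹ :=
    hP.mono (by norm_num)
  -- and it is `1/‖y + c‖ − 1/‖y‖` wherever `y ≠ 0`, `y + c ≠ 0`
  refine hP'.congr_far (R₁ := ‖c‖) fun y hy ↦ ?_
  have hc : 0 ≤ ‖c‖ := norm_nonneg c
  have hp : 0 < ‖y‖ := hc.trans_lt hy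
  have hq : 0 < ‖y + c‖ := by
    have := norm_sub_le (y + c) c
    rw [add_sub_cancel_right] at this
    linarith
  have hp' : ‖y‖ ≠ 0 := hp.ne'
  have hq' : ‖y + c‖ ≠ 0 := hq.ne'
  have hpq' : ‖y‖ + ‖y + c‖ ≠ 0 := by positivity
  have hsq := norm_sq_sub_norm_add_sq y c
  field_simp
  linear_combination (-1) * hsq

end Inner

/-! ### Conjugation of bilinear forms by a linear map -/

section Conj

variable {E : Type*} [NormedAddCommGroup E] [NormedSpace ℝ E]
  {E' : Type*} [NormedAddCommGroup E'] [NormedSpace ℝ E']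

/-- **Conjugation `T ↦ T(g·, g'·)` of continuous bilinear forms is a continuous linear map**
(`= T.bilinearComp g g'`). [folklore] -/
theorem ContinuousLinearMap.exists_bilinearCompCLM (g g' : E' →L[ℝ] E) :
    ∃ L : (E →L[ℝ] E →L[ℝ] ℝ) →L[ℝ] (E' →L[ℝ] E' →L[ℝ] ℝ),
      ∀ T : E →L[ℝ] E →L[ℝ] ℝ, L T = T.bilinearComp g g' := by
  refine ⟨(ContinuousLinearMap.compL ℝ E' (E →L[ℝ] ℝ) (E' →L[ℝ] ℝ)
      ((ContinuousLinearMap.compL ℝ E' E ℝ).flip g')).comp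
    ((ContinuousLinearMap.compL ℝ E' E (E →L[ℝ] ℝ)).flip g), fun T ↦ ?_⟩
  ext v w
  simp

variable {F : Type*} [NormedAddCommGroup F] [InnerProductSpace ℝ F]
  {F' : Type*} [NormedAddCommGroup F'] [InnerProductSpace ℝ F']

/-- A linear isometry fixes the Euclidean form: `δ(g v, g w) = δ(v, w)`. [folklore] -/
theorem innerSL_bilinearComp_linearIsometryEquiv (g : F' ≃ₗᵢ[ℝ] F) :
    (innerSL ℝ : F →L[ℝ] F →L[ℝ] ℝ).bilinearComp (g : F' →L[ℝ] F) (g : F' →L[ℝ] F) =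
      (innerSL ℝ : F' →L[ℝ] F' →L[ℝ] ℝ) := by
  ext v w
  simp [g.inner_map_map]

end Conj

/-! ### Decay classes of chart tensors under rigid motions -/

namespace IsBigOSmooth

variable {E : Type*} [NormedAddCommGroup E] [InnerProductSpace ℝ E]
  {E' : Type*} [NormedAddCommGroup E'] [InnerProductSpace ℝ E']

/-- **A bilinear-form-valued symbol, rigidly moved, is a symbol of the same order**: if
`T ∈ O_k(r^a)` then `y ↦ T(g y + c)(g·, g·) ∈ O_k(r^a)` (e.g. the second fundamental form
`k ∈ O₁(r⁻³)` of a Dafermos–Rodnianski end read in rotated and shifted axes). [folklore] -/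
theorem bilinForm_comp_rigid {k : ℕ} {a : ℝ} {T : E → E →L[ℝ] E →L[ℝ] ℝ}
    (hT : IsBigOSmooth k a T) (g : E' ≃ₗᵢ[ℝ] E) (c : E) :
    IsBigOSmooth k a fun y : E' ↦ (T (g y + c)).bilinearComp (g : E' →L[ℝ] E) (g : E' →L[ℝ] E) := by
  obtain ⟨L, hL⟩ := ContinuousLinearMap.exists_bilinearCompCLM (g : E' →L[ℝ] E) (g : E' →L[ℝ] E)
  exact ((hT.comp_rigid g c).clm_comp_left L).congr fun y ↦ hL _

/-- **The mass aspect is frame independent**: if `h − (1 + 2M/r) δ ∈ O₂(r⁻²)` in one chart, then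
in the rigidly moved chart `y ↦ g y + c` the metric `y ↦ h(g y + c)(g·, g·)` satisfies
`h' − (1 + 2M/r) δ ∈ O₂(r⁻²)` with the SAME `M`: rotations fix `δ` and `r`, and the shift of the
origin changes `2M/r` by `2M(1/‖y + g⁻¹c‖ − 1/‖y‖) ∈ O₂(r⁻²)`
(`isBigOSmooth_inv_norm_add_const_sub`). Regge–Teitelboim 1974, §5; Bartnik 1986, §4.
[folklore] -/
theorem massAspect_comp_rigid {h : E → E →L[ℝ] E →L[ℝ] ℝ} {M : ℝ}
    (hh : IsBigOSmooth 2 (-2) fun y : E ↦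
      h y - (1 + 2 * M * ‖y‖⁻¹) • (innerSL ℝ : E →L[ℝ] E →L[ℝ] ℝ))
    (g : E' ≃ₗᵢ[ℝ] E) (c : E) :
    IsBigOSmooth 2 (-2) fun y : E' ↦
      (h (g y + c)).bilinearComp (g : E' →L[ℝ] E) (g : E' →L[ℝ] E) -
        (1 + 2 * M * ‖y‖⁻¹) • (innerSL ℝ : E' →L[ℝ] E' →L[ℝ] ℝ) := by
  -- the moved deviation `(h − (1 + 2M/r)δ)(g y + c)(g·, g·) ∈ O₂(r⁻²)`
  have h1 := hh.bilinForm_comp_rigid g c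
  -- the potential shift `2M(1/‖g y + c‖ − 1/‖y‖) δ ∈ O₂(r⁻²)`, via `‖g y + c‖ = ‖y + g⁻¹ c‖`
  have h2 : IsBigOSmooth 2 (-2) fun y : E' ↦
      (2 * M * (‖g y + c‖⁻¹ - ‖y‖⁻¹)) • (innerSL ℝ : E' →L[ℝ] E' →L[ℝ] ℝ) := by
    have h3 : IsBigOSmooth 2 (-2) fun y : E' ↦ ‖y + g.symm c‖⁻¹ - ‖y‖⁻¹ :=
      isBigOSmooth_inv_norm_add_const_sub (g.symm c)
    refine ((h3.const_mul (2 * M)).smul_const (innerSL ℝ : E' →L[ℝ] E' →L[ℝ] ℝ)).congr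
      fun y ↦ ?_
    have hn : ‖g y + c‖ = ‖y + g.symm c‖ := by
      rw [← g.norm_map (y + g.symm c), map_add, LinearIsometryEquiv.apply_symm_apply]
    rw [hn]
  refine (h1.add h2).congr fun y ↦ ?_
  ext v w
  show h (g y + c) (g v) (g w) - (1 + 2 * M * ‖g y + c‖⁻¹) * ⟪g v, g w⟫_ℝ +
      2 * M * (‖g y + c‖⁻¹ - ‖y‖⁻¹) * ⟪v, w⟫_ℝ =
    h (g y + c) (g v) (g w) - (1 + 2 * M * ‖y‖⁻¹) * ⟪v, w⟫_ℝ
  rw [g.inner_map_map]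
  ring

end IsBigOSmooth

end Literature.Geometry.Lorentzian

end
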